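import Mathlib

/-!
# Rung for `stub_coneFatouEndgame` (LINE g18-A v5, crux ⟨stmt-QuantumFields-23125⟩): the ONE-CHANNEL endgame

The `A = {∗}`, `N ≡ 1` case of `ConeFatouEndgame` (the cone is `[0,∞)`, as for the lone sextic channel by `sextic_shellSign`):
a locally finite positive measure `σ` on `[0,∞)` whose `φ`-transforms `∫ φ(Mr) dσ(M)` tend to `0` as `r → 0⁺`, for a profile
`φ ≥ 0` measurable, continuous at `0` from the right, `φ(0) > 0`, is ZERO.  This is steps D–F of the stub plan
(`Lines/sextic_channel_stubplans.md` §2) in Lean: dominated convergence on `[0,N]`, then exhaustion.  Sorry-free.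
Seat ym-idea-3 g18 (planner; de-risking rung, not a registered stub).  HONEST LABEL: a lemma toward an M-stub of an OPEN line; nothing
about C3 / ⟨23125⟩ / the summit.
Second lemma (step A of the plan): `exists_strictlyPositive_functional` — a pointed closed convex cone cut out by linear
inequalities in `ℝ^A` carries a linear functional `e` with `c‖v‖ ≤ Σ_a e_a v_a` on the cone (`ProperCone.hyperplane_separation_point`
on `−C` + finite subcover of `C ∩ sphere` + minimum on the compact set).  With A and D–F in hand, `stub_coneFatouEndgame` reduces to the
P/Q bookkeeping (steps B–C: `P := Σ_a max(e_a,0)ρ⁺_a + max(−e_a,0)ρ⁻_a`, domination `|ρ⁺_b − ρ⁻_b|(S) ≤ c⁻¹ (P − Q)(S)`, `integral_mono_measure`).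
-/

open Filter Set MeasureTheory
open scoped Topology BigOperators

namespace Summit.QuantumFields.YangMills.Cruxes.RationalToGeneral.SexticChannel.Rung

theorem coneFatouEndgame_oneChannel (φ : ℝ → ℝ) (hφm : Measurable φ) (hφ0 : ∀ u, 0 ≤ φ u)
    (hφc : ContinuousWithinAt φ (Ici 0) 0) (hφpos : 0 < φ 0)
    (σ : Measure ℝ) [IsLocallyFiniteMeasure σ] (hsupp : σ (Iio 0) = 0)
    (hint : ∀ r : ℝ, 0 < r → Integrable (fun M => φ (M * r)) σ)
    (hbud : Tendsto (fun r : ℝ => ∫ M, φ (M * r) ∂σ) (𝓝[>] 0) (𝓝 0)) :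
    σ = 0 := by
  -- Step 1: for every `N > 0`, `σ [0,N] = 0`.
  have hIcc : ∀ N : ℝ, 0 < N → σ (Icc 0 N) = 0 := by
    intro N hN
    have hfin : σ (Icc 0 N) < ⊤ := measure_Icc_lt_top
    -- a bound for `φ` near `0⁺`
    obtain ⟨δ, hδ, hδφ⟩ : ∃ δ > 0, ∀ u, 0 ≤ u → u < δ → φ u ≤ φ 0 + 1 := by
      have := Metric.continuousWithinAt_iff.mp hφc 1 one_pos
      obtain ⟨δ, hδ, h⟩ := this
      refine ⟨δ, hδ, fun u hu hud => ?_⟩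
      have h' := h (x := u) hu (by simpa [Real.dist_eq, abs_of_nonneg hu] using hud)
      rw [Real.dist_eq] at h'
      linarith [le_abs_self (φ u - φ 0)]
    -- restricted (finite) measure
    set ν : Measure ℝ := σ.restrict (Icc 0 N) with hν
    haveI : IsFiniteMeasure ν := by
      rw [hν]; exact ⟨by simpa using hfin⟩
    -- DCT: ∫ φ(M r) dν → φ 0 * ν univ
    have hlim : Tendsto (fun r : ℝ => ∫ M, φ (M * r) ∂ν) (𝓝[>] 0) (𝓝 (∫ _M, φ 0 ∂ν)) := by
      refine tendsto_integral_filter_of_dominated_convergence (fun _ => φ 0 + 1) ?_ ?_ (integrable_const _) ?_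
      · exact Eventually.of_forall fun r =>
          (hφm.comp (measurable_id.mul_const r)).aestronglyMeasurable
      · -- eventually (r < δ / (N + 1)) the integrand is bounded on [0, N]
        have hev : ∀ᶠ r : ℝ in 𝓝[>] 0, 0 < r ∧ r < δ / (N + 1) := by
          have h1 : ∀ᶠ r : ℝ in 𝓝[>] 0, 0 < r := self_mem_nhdsWithin
          have h2 : ∀ᶠ r : ℝ in 𝓝[>] 0, r < δ / (N + 1) :=
            mem_nhdsWithin_of_mem_nhds (Iio_mem_nhds (by positivity))
          exact h1.and h2
        refine hev.mono fun r hr => ?_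
        rw [hν, ae_restrict_iff' measurableSet_Icc]
        refine Eventually.of_forall fun M hM => ?_
        rw [Real.norm_eq_abs, abs_of_nonneg (hφ0 _)]
        refine hδφ _ (mul_nonneg hM.1 hr.1.le) ?_
        calc M * r ≤ N * r := mul_le_mul_of_nonneg_right hM.2 hr.1.le
          _ < N * (δ / (N + 1)) := mul_lt_mul_of_pos_left hr.2 hN
          _ ≤ δ := by
              rw [mul_div_assoc']
              rw [div_le_iff₀ (by positivity)]
              nlinarith
      · rw [hν, ae_restrict_iff' measurableSet_Icc]
        refine Eventually.of_forall fun M hM => ?_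
        -- φ (M r) → φ 0 as r → 0⁺, for M ≥ 0
        have hMr : Tendsto (fun r : ℝ => M * r) (𝓝[>] 0) (𝓝[Ici 0] 0) := by
          refine tendsto_nhdsWithin_iff.mpr ⟨?_, ?_⟩
          · have : Tendsto (fun r : ℝ => M * r) (𝓝 0) (𝓝 (M * 0)) :=
              tendsto_const_nhds.mul tendsto_id
            rw [mul_zero] at this
            exact tendsto_nhdsWithin_of_tendsto_nhds this
          · filter_upwards [self_mem_nhdsWithin] with r hr
            exact mul_nonneg hM.1 (le_of_lt hr)
        exact hφc.tendsto.comp hMr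
    have hconst : ∫ _M, φ 0 ∂ν = (σ (Icc 0 N)).toReal * φ 0 := by
      rw [integral_const, smul_eq_mul, hν]
      simp [measureReal_def]
    rw [hconst] at hlim
    -- comparison: ∫ φ(M r) dν ≤ ∫ φ(M r) dσ for r > 0
    have hle : ∀ᶠ r : ℝ in 𝓝[>] 0, ∫ M, φ (M * r) ∂ν ≤ ∫ M, φ (M * r) ∂σ := by
      filter_upwards [self_mem_nhdsWithin] with r hr
      rw [hν]
      exact setIntegral_le_integral (hint r hr) (Eventually.of_forall fun M => hφ0 _)
    have hnonpos : (σ (Icc 0 N)).toReal * φ 0 ≤ 0 := le_of_tendsto_of_tendsto hlim hbud hle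
    have htr : (σ (Icc 0 N)).toReal = 0 := by
      have h1 : 0 ≤ (σ (Icc 0 N)).toReal := ENNReal.toReal_nonneg
      nlinarith
    exact (ENNReal.toReal_eq_zero_iff _).mp htr |>.resolve_right hfin.ne
  -- Step 2: exhaustion `ℝ = (-∞,0) ∪ ⋃_N [0, N+1]`.
  rw [← Measure.measure_univ_eq_zero]
  have hcover : (univ : Set ℝ) ⊆ Iio 0 ∪ ⋃ n : ℕ, Icc 0 ((n : ℝ) + 1) := by
    intro x _
    by_cases hx : x < 0
    · exact Or.inl hx
    · refine Or.inr (mem_iUnion.mpr ⟨⌈x⌉₊, ?_⟩)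
      exact ⟨le_of_not_gt hx, (Nat.le_ceil x).trans (le_add_of_nonneg_right zero_le_one)⟩
  refine measure_mono_null hcover ?_
  refine measure_union_null hsupp ?_
  exact measure_iUnion_null fun n => hIcc _ (by positivity)

/-- A pointed closed convex cone cut out by linear inequalities in `ℝ^A` carries a strictly positive linear functional:
`c‖v‖ ≤ Σ_a e_a v_a` on the cone. -/
theorem exists_strictlyPositive_functional {A : Type} [Fintype A] {Q : Type} (N : A → Q → ℝ)
    (hpt : ∀ v : A → ℝ, (∀ q, ∑ a, v a * N a q = 0) → v = 0) :
    ∃ (e : A → ℝ) (c : ℝ), 0 < c ∧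
      ∀ v : A → ℝ, (∀ q, 0 ≤ ∑ a, v a * N a q) → c * ‖v‖ ≤ ∑ a, e a * v a := by
  classical
  -- the cone and its negative as a proper cone
  set Cset : Set (A → ℝ) := {v | ∀ q, 0 ≤ ∑ a, v a * N a q} with hCset
  have hCclosed : IsClosed Cset := by
    rw [hCset]
    simp only [setOf_forall]
    exact isClosed_iInter fun q => isClosed_le continuous_const (by fun_prop)
  let negC : ProperCone ℝ (A → ℝ) :=
    { carrier := {v | ∀ q, ∑ a, v a * N a q ≤ 0}
      add_mem' := by
        intro v w hv hw q
        have := add_le_add (hv q) (hw q)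
        simpa [Pi.add_apply, add_mul, Finset.sum_add_distrib] using this
      zero_mem' := by intro q; simp
      smul_mem' := by
        intro c v hv q
        have h := mul_nonpos_of_nonneg_of_nonpos c.2 (hv q)  -- 0 ≤ c, sum ≤ 0
        have : ∑ a, (c • v) a * N a q = (c : ℝ) * ∑ a, v a * N a q := by
          rw [Finset.mul_sum]
          refine Finset.sum_congr rfl fun a _ => ?_
          rw [Pi.smul_apply, ← Nonneg.coe_smul, smul_eq_mul, mul_assoc]
        rw [this]; exact h
      isClosed' := by
        simp only [setOf_forall]
        exact isClosed_iInter fun q => isClosed_le (by fun_prop) continuous_const }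
  have hnegC_mem : ∀ v : A → ℝ, v ∈ negC ↔ ∀ q, ∑ a, v a * N a q ≤ 0 := fun v => Iff.rfl
  -- for each nonzero cone vector, a functional nonneg on C and positive at it
  have hsep : ∀ v ∈ Cset, v ≠ 0 → ∃ g : (A → ℝ) →L[ℝ] ℝ, (∀ w ∈ Cset, 0 ≤ g w) ∧ 0 < g v := by
    intro v hv hv0
    have hvn : v ∉ negC := by
      intro h
      apply hv0
      apply hpt
      intro q
      exact le_antisymm ((hnegC_mem v).mp h q) (hv q)
    obtain ⟨f, hf, hfv⟩ := ProperCone.hyperplane_separation_point negC hvn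
    refine ⟨-f, fun w hw => ?_, by simpa using hfv⟩
    have hnw : -w ∈ negC := by
      rw [hnegC_mem]
      intro q
      have := hw q
      simp only [Pi.neg_apply, neg_mul, Finset.sum_neg_distrib, neg_nonpos]
      exact this
    have := hf (-w) hnw
    simpa using this
  choose! g hgC hgpos using hsep
  -- compact set K = C ∩ unit sphere, finite subcover by the positivity sets of the g_v
  set K : Set (A → ℝ) := Cset ∩ Metric.sphere 0 1 with hK
  have hKc : IsCompact K := (isCompact_sphere (0 : A → ℝ) 1).inter_left hCclosed
  have hKsub : K ⊆ ⋃ v : K, {w | 0 < g v w} := by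
    intro w hw
    refine mem_iUnion.mpr ⟨⟨w, hw⟩, ?_⟩
    have hw0 : w ≠ 0 := by
      intro h; have := hw.2; rw [h] at this; simp at this
    exact hgpos w hw.1 hw0
  obtain ⟨t, ht⟩ := hKc.elim_finite_subcover (fun v : K => {w | 0 < g v w})
    (fun v => isOpen_lt continuous_const (g v).continuous) hKsub
  -- the functional E := Σ_{v ∈ t} g_v
  let E : (A → ℝ) →L[ℝ] ℝ := ∑ v ∈ t, g (v : A → ℝ)
  have hE_apply : ∀ w, E w = ∑ v ∈ t, g (v : A → ℝ) w := by
    intro w; simp [E]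
  have hE_nonneg : ∀ w ∈ Cset, 0 ≤ E w := by
    intro w hw; rw [hE_apply]
    exact Finset.sum_nonneg fun v _ => hgC _ v.2.1 (by
      intro h; have := v.2.2; rw [h] at this; simp at this) w hw
  have hE_pos : ∀ w ∈ K, 0 < E w := by
    intro w hw
    have hw' := ht hw
    rw [mem_iUnion₂] at hw'
    obtain ⟨v, hvt, hvw⟩ := hw'
    rw [hE_apply]
    rw [← Finset.add_sum_erase _ _ hvt]
    refine add_pos_of_pos_of_nonneg hvw (Finset.sum_nonneg fun u _ => ?_)
    exact hgC _ u.2.1 (by intro h; have := u.2.2; rw [h] at this; simp at this) w hw.1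
  -- coordinates of E
  refine ⟨fun a => E (Pi.single a 1), ?_⟩
  have hE_coord : ∀ w : A → ℝ, E w = ∑ a, E (Pi.single a 1) * w a := by
    intro w
    conv_lhs => rw [← Finset.univ_sum_single w]
    rw [map_sum]
    refine Finset.sum_congr rfl fun a _ => ?_
    rw [show Pi.single a (w a) = w a • (Pi.single a (1 : ℝ) : A → ℝ) by
      rw [← Pi.single_smul' a (w a) (1 : ℝ), smul_eq_mul, mul_one]]
    rw [map_smul, smul_eq_mul, mul_comm]
  by_cases hKne : K.Nonempty
  · obtain ⟨w₀, hw₀K, hmin⟩ := hKc.exists_isMinOn hKne E.continuous.continuousOn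
    refine ⟨E w₀, hE_pos w₀ hw₀K, fun v hv => ?_⟩
    have hE_coord' : ∑ a, E (Pi.single a 1) * v a = E v := (hE_coord v).symm
    rw [hE_coord']
    by_cases hv0 : v = 0
    · subst hv0; simp
    · have hvn : 0 < ‖v‖ := norm_pos_iff.mpr hv0
      have hu : ‖v‖⁻¹ • v ∈ K := by
        refine ⟨?_, ?_⟩
        · intro q
          have := mul_nonneg (inv_nonneg.mpr hvn.le) (hv q)
          simpa [Pi.smul_apply, smul_eq_mul, Finset.mul_sum, mul_assoc] using this
        · rw [mem_sphere_zero_iff_norm, norm_smul, norm_inv, norm_norm, inv_mul_cancel₀ hvn.ne']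
      have h1 : E w₀ ≤ E (‖v‖⁻¹ • v) := hmin hu
      rw [map_smul, smul_eq_mul] at h1
      have h2 : E w₀ * ‖v‖ ≤ ‖v‖⁻¹ * E v * ‖v‖ := mul_le_mul_of_nonneg_right h1 hvn.le
      calc E w₀ * ‖v‖ ≤ ‖v‖⁻¹ * E v * ‖v‖ := h2
        _ = E v := by field_simp
  · refine ⟨1, one_pos, fun v hv => ?_⟩
    have hv0 : v = 0 := by
      by_contra h
      have hvn : 0 < ‖v‖ := norm_pos_iff.mpr h
      apply hKne
      refine ⟨‖v‖⁻¹ • v, ?_, ?_⟩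
      · intro q
        have := mul_nonneg (inv_nonneg.mpr hvn.le) (hv q)
        simpa [Pi.smul_apply, smul_eq_mul, Finset.mul_sum, mul_assoc] using this
      · rw [mem_sphere_zero_iff_norm, norm_smul, norm_inv, norm_norm, inv_mul_cancel₀ hvn.ne']
    subst hv0; simp


end Summit.QuantumFields.YangMills.Cruxes.RationalToGeneral.SexticChannel.Rung
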